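import Literature.AlgebraicGeometry.HodgeTheory.CartierDivisorChernClass
import Literature.Geometry.Kaehler.HolomorphicLineBundleSections
import Summits.HodgeConjecture.HodgeConjecture.Theorems.NikulinTwinTransportLefschetzOneOneK3AlgebraicTwist
import Literature.AlgebraicGeometry.HodgeTheory.SerreTheoremALineBundles

/-!
# Route NikulinTwinTransport — `LefschetzOneOneK3` closed modulo Serre's Théorème A for line cocycles on surfaces

Helper file (`--supports stmt-HodgeConjecture-13678`). The route item `LefschetzOneOneK3` (Lefschetz `(1,1)`
for the projective K3 surfaces of the route) is proved in the tree from the existence of ONE non-zero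
holomorphic section of `L ⊗ 𝒪_S(D)^an` — `D` a Cartier divisor with a non-zero algebraic section — for
every holomorphic line cocycle `L` on a Hodge model of a surface of the item
(`lefschetzOneOneK3_of_exists_section_algebraicTwist`; analytic Lefschetz `(1,1)`, Čech integrality, Chow,
`σ₁/σ₂`, `c₁(𝒪(D)^an)` algebraic and `s ↦ s^an` all being theorems of the tree). This file names that
input as what it is in print — Serre's Théorème A (GAGA n° 16) for the coherent analytic sheaf of
sections of `L`, on a smooth projective SURFACE, in sections form — and records the closure:

* `serre_theoremA_lineCocycle_surface` (named fact) and
* `lefschetzOneOneK3_of_serre_theoremA_lineCocycle_surface : Literature.AlgebraicGeometry.HodgeTheory.serre_theoremA_lineCocycle_surface → LefschetzOneOneK3`.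

The fact is WEAKER than GAGA for line bundles (`serreGAGA_lineCocycle_iso_cartierDivisorCocycle`, from
which it follows with the algebraic theorem A), and it is the statement proved by the
Euler-characteristic route of `NikulinTwinTransportLefschetzOneOneK3EulerCharacteristic` (Cartan–Serre
finiteness for `H^{0,q}_∂̄(S^an; L)`, `q = 1, 2`, two long exact sequences, Bertini; no Théorème 3, no
Kodaira vanishing, no Serre duality).
-/

noncomputable section

namespace Summit.HodgeConjecture.HodgeConjecture.Theorems

/-! ### Serre's Théorème A for line cocycles on surfaces, and the closure of the item -/

/-- **`LefschetzOneOneK3` from Serre's Théorème A for line cocycles on surfaces**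
(`lefschetzOneOneK3_of_exists_section_algebraicTwist` fed with the fact; only `IsSmoothProjective 2 S`
of the K3 clause is used). [cite: SerreGAGA1956, n° 16–17] [cite: VoisinHodgeI2002, Thm. 11.30 and Cor. 11.34] -/
theorem lefschetzOneOneK3_of_serre_theoremA_lineCocycle_surface
    (h : Literature.AlgebraicGeometry.HodgeTheory.serre_theoremA_lineCocycle_surface) :
    Summit.HodgeConjecture.HodgeConjecture.Theses.NikulinTwinTransport.LefschetzOneOneK3 :=
  lefschetzOneOneK3_of_exists_section_algebraicTwist fun _ hS A ι L ↦ h hS.1 A ι L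

end Summit.HodgeConjecture.HodgeConjecture.Theorems

end
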